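import Summits.HodgeConjecture.HodgeConjecture.Theorems.R90S10LocalCarrierTransport   -- ★ p863234 (R90-C138-p05): `mem_borelU_iff_of_coe_eq`, `mem_unipotentU_iff_of_coe_eq`, `mem_torusU_of_coe_eq` (B, N, T move entrywise along `Φ`)
import Literature.NumberTheory.Automorphic.UnitaryGroupPrincipalSeriesH                 -- ★ `cmPrincipalSeriesH`, `cmPrincipalSeriesH_apply`, `HLengthTwoLabels`
import Literature.NumberTheory.Automorphic.SmoothIndTransport                          -- ★ `SmoothInd.transportEquiv`, `transportEquiv_smoothIndRep`, `rootDeltaChar_transport`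
import Literature.NumberTheory.Automorphic.UnitaryGroupUnipotentLimitCompactOpen       -- ★ `isLimitOfCompactOpen_cmBorelTriple_N`
import Literature.NumberTheory.Automorphic.JacquetNonzeroEmbedsNormalizedInd           -- ★ `ParabolicTriple.rootDeltaChar_eq_one_of_isLimitOfCompactOpen`
import Literature.NumberTheory.Automorphic.IrreducibleClassesComap                     -- ★ `IrrClass.comap`, `comap_isConstituentOf_comp_iff`, `comap_comap_symm`
import Literature.NumberTheory.Automorphic.IrreducibleClassesConstituents              -- ★ `IrrClass.isConstituentOf_congr`
import HarnessLib

/-!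
# R90-TF · S10 (Rogawski 1990 §13.8) — THE PRINCIPAL SERIES OF `U(Φ_N)(L⁺_v)` AND THE LABELS `JH(i_H(χ₂ ⊠ χ₁)) = {π₁, πSt}` TRANSPORT
# ALONG A GROUND-FIELD CHANGE `(Φ, e_N, e_H)`

Cell `hodgecm-mathlib`, crux H413 (`stmt-HodgeConjecture-24833`), route of record `HCCMUnconditional`; slab R90-TF, section S10 = §13.8, seat
R90-C138-p06 (g0), card «(U2) head `sock_S10_localTransportStBeta`» (DEAL-S10-WAVE1, R90-C138-plan (g2)).  Helper file №1 of the (U2) payer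
`Theorems/R90S10StSpectralHypAtTransport.lean` (lane `--supports stmt-HodgeConjecture-24833 --as helper`; THEOREMS ONLY — no definition, no instance,
no notation, no `sorry`; ★-only imports, never a `Cruxes/…/Lines` file (law L9)).

THE MATHEMATICS [Rogawski1990 §12.1 pp. 171–172, §14.2 p. 232 «`G′_v` is isomorphic to `G_v` … `f_v = f′_v ∘ ψ_v⁻¹`»; BernsteinZelevinsky1977 §2.3].
Let `Φ : L ⊗ L⁺_v ≃+* L′ ⊗ L′⁺_{v′}` be S3's ring-level local-transport datum and `e : U(Φ_N)(L⁺_v) ≃ₜ* U(Φ_N)(L′⁺_{v′})` the induced isomorphism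
(`(e g)_{ij} = Φ(g_{ij})`, ★ `exists_cmDatum_local_equiv`).  Then `e` carries the Borel pair `(B, T, N)` onto `(B′, T′, N′)` (★ p863234
`mem_borelU_iff_of_coe_eq` ∕ `mem_torusU_of_coe_eq` ∕ `mem_unipotentU_iff_of_coe_eq`) and the modulus `δ_B^{1/2}` onto `δ_{B′}^{1/2}` (★
`rootDeltaChar_transport`, uniqueness of Haar measure), so for torus characters with `χ′ ∘ e = χ` the inducing characters agree (§1
`borelChar_transport`) and `f ↦ f ∘ e⁻¹` is an isomorphism **`i(χ) ≅ i(χ′) ∘ e`** (§1 `nonempty_equiv_cmPrincipalSeries_transport`, ★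
`SmoothInd.transportEquiv`).  On `H_v = U(Φ₂)_v × U(Φ₁)_v` with `e_H = e₂ × e₁`: **`i_H(χ₂ ⊠ χ₁) ≅ i_{H′}(χ₂′ ⊠ χ₁′) ∘ e_H`** (§2, `i_H = i(χ₂) ∘ fst ⊗ χ₁ ∘ snd`
definitionally), hence the LABELS transport: **`JH(i_H(χ₂ ⊠ χ₁)) = {π₁, πSt} ⟹ JH(i_{H′}(χ₂′ ⊠ χ₁′)) = {e_H^* π₁, e_H^* πSt}`** with `e_H^* = IrrClass.comap e_H⁻¹`
(§2 `hLengthTwoLabels_transport`; ★ `comap_isConstituentOf_comp_iff`, ★ `isConstituentOf_congr`).  This is the `HLengthTwoLabels` carrier of the organ letter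
(S-β) `StSpectralHypAt` — brick C9 of S3's census `CENSUS-J-S3-3-carriers.v1.md` at EXPLICIT characters (G3a states only the `∃`-form).
HONEST LABEL: transport of structure, no print input; HC_CM is proved only modulo the 7 printed citations (2 remaining named inputs: hLiu418 =
stmt-HodgeConjecture-24832, h413 = stmt-HodgeConjecture-24833) until rung 0 closes; a ★ helper pays no socket until the U Lines edition names it.

## References
* [Rogawski1990] J. D. Rogawski, *Automorphic Representations of Unitary Groups in Three Variables*, Ann. of Math. Stud. 123 (1990), §1.10 p. 9, §12.1
  pp. 171–172, §12.2 p. 173, §14.2 p. 232.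
* [BernsteinZelevinsky1977] I. N. Bernstein, A. V. Zelevinsky, *Induced representations of reductive p-adic groups I*, Ann. Sci. ÉNS 10 (1977), §1.8, §2.3.
* [BushnellHenniart2006] C. J. Bushnell, G. Henniart, *The Local Langlands Conjecture for GL(2)*, Grundlehren 335 (2006), §1.1, §2.4.
-/

set_option autoImplicit false
-- the mandated namespace repeats the single-problem summit's segment (`HodgeConjecture.HodgeConjecture`)
set_option linter.dupNamespace false

noncomputable section

open NumberField IsDedekindDomain
open scoped Matrix MatrixGroups
open Literature.NumberTheory Literature.NumberTheory.Automorphic Literature.NumberTheory.Automorphic.UnitaryGroup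
open Literature.NumberTheory.Rogawski1990 Literature.NumberTheory.GaloisRepresentations

namespace Summit.HodgeConjecture.HodgeConjecture.R90.S10

/-! ## §1 The principal series `i(χ)` of `U(Φ_N)(L⁺_v)` along `e : U(Φ_N)(L⁺_v) ≃ₜ* U(Φ_N)(L′⁺_{v′})` -/

section PrincipalSeries

variable (L : Type) [Field L] [NumberField L] [IsCMField L] (v : HeightOneSpectrum (𝓞 ↥(maximalRealSubfield L)))
  (L' : Type) [Field L'] [NumberField L'] [IsCMField L'] (v' : HeightOneSpectrum (𝓞 ↥(maximalRealSubfield L')))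
  (Φ : UnitaryGroup.LocalRing L v ≃+* UnitaryGroup.LocalRing L' v') (N : ℕ)
  (e : ↥(unitaryGroupOfForm (conjLocal L (IsCMField.complexConj L) v) (cmLocalForm L N v)) ≃ₜ*
    ↥(unitaryGroupOfForm (conjLocal L' (IsCMField.complexConj L') v') (cmLocalForm L' N v')))
  (he : ∀ g, ((e g).val : GL (Fin N) (UnitaryGroup.LocalRing L' v')) =
    Matrix.GeneralLinearGroup.map (Φ : UnitaryGroup.LocalRing L v →+* UnitaryGroup.LocalRing L' v')
      (g.val : GL (Fin N) (UnitaryGroup.LocalRing L v)))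
  (χ : ↥(torusU (conjLocal L (IsCMField.complexConj L) v) (cmLocalForm L N v)) →* ℂˣ)
  (χ' : ↥(torusU (conjLocal L' (IsCMField.complexConj L') v') (cmLocalForm L' N v')) →* ℂˣ)
  (hχ : ∀ (t : ↥(torusU (conjLocal L (IsCMField.complexConj L) v) (cmLocalForm L N v)))
    (ht' : (e t.1) ∈ torusU (conjLocal L' (IsCMField.complexConj L') v') (cmLocalForm L' N v')), χ' ⟨e t.1, ht'⟩ = χ t)

include he in
/-- `e` carries the Borel `B(L⁺_v)` onto `B(L′⁺_{v′})` (★ `mem_borelU_iff_of_coe_eq`). [cite: Rogawski1990, §1.10 p. 9] -/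
theorem apply_mem_cmBorel_iff (g : ↥(unitaryGroupOfForm (conjLocal L (IsCMField.complexConj L) v) (cmLocalForm L N v))) :
    e g ∈ (cmBorelTriple L' N v').P ↔ g ∈ (cmBorelTriple L N v).P :=
  mem_borelU_iff_of_coe_eq Φ g (e g) (he g)

include he hχ in
set_option maxHeartbeats 2000000 in
/-- **The inducing characters agree along `e`**: for `p ∈ B(L⁺_v)`, `(χ ∘ proj)(p)·δ_B^{1/2}(p) = (χ′ ∘ proj′)(e p)·δ_{B′}^{1/2}(e p)` — write `p = t·n`
(`t = proj p`); `e t ∈ T′`, `e n ∈ N′`, so `proj′(e p) = e t` and `χ′(e t) = χ(t)`; the modulus is intrinsic (★ `rootDeltaChar_transport`).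
[cite: BernsteinZelevinsky1977, §1.8, §2.3] [cite: Rogawski1990, §12.1 p. 171] -/
theorem borelChar_transport (p : ↥(cmBorelTriple L N v).P) :
    (haveI := locallyCompactSpace_cmBorelU L N v;
      Representation.twist
        (((Representation.trivial ℂ ↥(torusU (conjLocal L (IsCMField.complexConj L) v) (cmLocalForm L N v)) ℂ).twist χ).comp
          (cmBorelTriple L N v).proj)
        (rootDeltaChar (cmBorelTriple L N v).P) p) =
    (haveI := locallyCompactSpace_cmBorelU L' N v';
      Representation.twist
        (((Representation.trivial ℂ ↥(torusU (conjLocal L' (IsCMField.complexConj L') v') (cmLocalForm L' N v')) ℂ).twist χ').comp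
          (cmBorelTriple L' N v').proj)
        (rootDeltaChar (cmBorelTriple L' N v').P) ⟨e p.1, (apply_mem_cmBorel_iff L v L' v' Φ N e he p.1).2 p.2⟩) := by
  haveI := locallyCompactSpace_cmBorelU L N v
  haveI := locallyCompactSpace_cmBorelU L' N v'
  -- the Levi decomposition `p = t · n`, `t = proj p`, and the images `e t ∈ T′`, `e n ∈ N′`
  have hn := (cmBorelTriple L N v).proj_inv_mul_mem p
  have het : e ((cmBorelTriple L N v).proj p).1 ∈ torusU (conjLocal L' (IsCMField.complexConj L') v') (cmLocalForm L' N v') :=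
    mem_torusU_of_coe_eq Φ _ _ (he _) ((cmBorelTriple L N v).proj p).2
  have hen : e ((((cmBorelTriple L N v).proj p).1)⁻¹ * p.1) ∈ (cmBorelTriple L' N v').N :=
    (mem_unipotentU_iff_of_coe_eq Φ _ _ (he _)).2 hn
  have hprod : (⟨e p.1, (apply_mem_cmBorel_iff L v L' v' Φ N e he p.1).2 p.2⟩ : ↥(cmBorelTriple L' N v').P) =
      ⟨e ((cmBorelTriple L N v).proj p).1, (cmBorelTriple L' N v').M_le het⟩ * ⟨e _, (cmBorelTriple L' N v').N_le hen⟩ :=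
    Subtype.ext (by rw [Subgroup.coe_mul, ← map_mul, mul_inv_cancel_left])
  have hproj' : (cmBorelTriple L' N v').proj ⟨e p.1, (apply_mem_cmBorel_iff L v L' v' Φ N e he p.1).2 p.2⟩ =
      ⟨e ((cmBorelTriple L N v).proj p).1, het⟩ := by
    rw [hprod, map_mul, (cmBorelTriple L' N v').proj_apply_of_mem_N ⟨e _, (cmBorelTriple L' N v').N_le hen⟩ hen, mul_one]
    exact Subtype.ext ((cmBorelTriple L' N v').proj_apply_of_mem_M ⟨e ((cmBorelTriple L N v).proj p).1, (cmBorelTriple L' N v').M_le het⟩ het)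
  have hδ : rootDeltaChar (cmBorelTriple L N v).P p =
      rootDeltaChar (cmBorelTriple L' N v').P ⟨e p.1, (apply_mem_cmBorel_iff L v L' v' Φ N e he p.1).2 p.2⟩ :=
    Representation.rootDeltaChar_transport e.toMulEquiv e.continuous e.symm.continuous
      (H := (cmBorelTriple L' N v').P) (H' := (cmBorelTriple L N v).P) (fun x => apply_mem_cmBorel_iff L v L' v' Φ N e he x) p
  refine LinearMap.ext fun z => ?_
  simp only [Representation.twist_apply, MonoidHom.comp_apply]
  rw [hproj', hδ, hχ _ het]
  rfl

include he hχ in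
set_option maxHeartbeats 1600000 in
/-- **TRANSPORT OF THE PRINCIPAL SERIES ALONG A GROUND-FIELD CHANGE**: `i(χ) ≅ i(χ′) ∘ e` (`f ↦ f ∘ e⁻¹`, ★ `SmoothInd.transportEquiv` at `H′ = B`, `H = B′` with
§1's agreement of the inducing characters). «If `G′_v ≅ G_v`, representations correspond.» [cite: BernsteinZelevinsky1977, §2.3] [cite: Rogawski1990, §12.1 p. 171; §14.2 p. 232] -/
theorem nonempty_equiv_cmPrincipalSeries_transport :
    Nonempty (Representation.Equiv (cmPrincipalSeries L N v χ)
      ((cmPrincipalSeries L' N v' χ').comp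
        (e : ↥(unitaryGroupOfForm (conjLocal L (IsCMField.complexConj L) v) (cmLocalForm L N v)) →*
          ↥(unitaryGroupOfForm (conjLocal L' (IsCMField.complexConj L') v') (cmLocalForm L' N v'))))) := by
  haveI := locallyCompactSpace_cmBorelU L N v
  haveI := locallyCompactSpace_cmBorelU L' N v'
  exact ⟨Representation.Equiv.mk
    (Representation.SmoothInd.transportEquiv (k := ℂ) e.toMulEquiv e.continuous e.symm.continuous
      (H := (cmBorelTriple L' N v').P) (H' := (cmBorelTriple L N v).P)
      (σ := Representation.twist
          (((Representation.trivial ℂ ↥(torusU (conjLocal L' (IsCMField.complexConj L') v') (cmLocalForm L' N v')) ℂ).twist χ').comp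
            (cmBorelTriple L' N v').proj)
          (rootDeltaChar (cmBorelTriple L' N v').P))
      (σ' := Representation.twist
          (((Representation.trivial ℂ ↥(torusU (conjLocal L (IsCMField.complexConj L) v) (cmLocalForm L N v)) ℂ).twist χ).comp
            (cmBorelTriple L N v).proj)
          (rootDeltaChar (cmBorelTriple L N v).P))
      (fun x => apply_mem_cmBorel_iff L v L' v' Φ N e he x) (fun p => borelChar_transport L v L' v' Φ N e he χ χ' hχ p))
    fun g => LinearMap.ext fun f =>
      Representation.SmoothInd.transportEquiv_smoothIndRep e.toMulEquiv e.continuous e.symm.continuous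
        (fun x => apply_mem_cmBorel_iff L v L' v' Φ N e he x) (fun p => borelChar_transport L v L' v' Φ N e he χ χ' hχ p) g f⟩

end PrincipalSeries


/-! ## §2a Generic: an equivalence `ρ ≅ ρ′ ∘ e_A` and characters `χ′ ∘ e_B = χ` give `(ρ ∘ fst) ⊗ (χ ∘ snd) ≅ ((ρ′ ∘ fst) ⊗ (χ′ ∘ snd)) ∘ (e_A × e_B)` -/

section GenericTwist

variable {A B A' B' : Type*} [Group A] [Group B] [Group A'] [Group B']
  {V W : Type*} [AddCommGroup V] [Module ℂ V] [AddCommGroup W] [Module ℂ W]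

/-- **Box-twist transport (generic)**: from `E : ρ ≅ ρ′ ∘ e_A` and `χ′ ∘ e_B = χ`, the same linear isomorphism intertwines `(ρ ∘ fst) ⊗ (χ ∘ snd)` with
`((ρ′ ∘ fst) ⊗ (χ′ ∘ snd)) ∘ e` for any `e` with `e h = (e_A h.1, e_B h.2)`. [cite: BushnellHenniart2006, §1.1] [cite: Rogawski1990, §12.1 p. 171] -/
theorem nonempty_equiv_twist_fst_snd_comp (ρ : Representation ℂ A V) (ρ' : Representation ℂ A' W) (eA : A →* A')
    (E : ρ.Equiv (ρ'.comp eA)) (χ : B →* ℂˣ) (χ' : B' →* ℂˣ) (eB : B →* B') (hχ : ∀ b, χ' (eB b) = χ b)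
    (e : A × B →* A' × B') (he : ∀ h, e h = (eA h.1, eB h.2)) :
    Nonempty (Representation.Equiv
      (Representation.twist (ρ.comp (MonoidHom.fst A B)) (χ.comp (MonoidHom.snd A B)))
      ((Representation.twist (ρ'.comp (MonoidHom.fst A' B')) (χ'.comp (MonoidHom.snd A' B'))).comp e)) := by
  refine ⟨Representation.Equiv.mk E.toLinearEquiv fun h => LinearMap.ext fun v => ?_⟩
  have hE : E.toLinearEquiv (ρ h.1 v) = ρ' (eA h.1) (E.toLinearEquiv v) := by
    rw [Representation.Equiv.toLinearEquiv_apply, Representation.Equiv.toLinearEquiv_apply]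
    exact E.toIntertwiningMap.isIntertwining _ _ h.1 v
  rw [LinearMap.comp_apply, LinearMap.comp_apply, LinearEquiv.coe_coe, MonoidHom.comp_apply, he,
    Representation.twist_apply, Representation.twist_apply, MonoidHom.comp_apply, MonoidHom.comp_apply,
    MonoidHom.comp_apply, MonoidHom.comp_apply, MonoidHom.coe_fst, MonoidHom.coe_snd, MonoidHom.coe_fst,
    MonoidHom.coe_snd, map_smul, hE, hχ]

end GenericTwist

/-! ## §2 `H_v = U(Φ₂)_v × U(Φ₁)_v`: `i_H(χ₂ ⊠ χ₁)` and the labels `JH(i_H(χ₂ ⊠ χ₁)) = {π₁, πSt}` along `e_H = e₂ × e₁` -/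

section Labels

variable (L : Type) [Field L] [NumberField L] [IsCMField L] (v : HeightOneSpectrum (𝓞 ↥(maximalRealSubfield L)))
  (L' : Type) [Field L'] [NumberField L'] [IsCMField L'] (v' : HeightOneSpectrum (𝓞 ↥(maximalRealSubfield L')))
  (Φ : UnitaryGroup.LocalRing L v ≃+* UnitaryGroup.LocalRing L' v')
  (e₂ : (UnitaryGroup.cmDatum L 2 (Matrix.of fun i j : Fin 2 => if i.val + j.val + 1 = 2 then (1 : L) else 0)).Local v ≃ₜ*
    (UnitaryGroup.cmDatum L' 2 (Matrix.of fun i j : Fin 2 => if i.val + j.val + 1 = 2 then (1 : L') else 0)).Local v')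
  (he₂ : ∀ g, ((e₂ g).val : GL (Fin 2) (UnitaryGroup.LocalRing L' v')) =
    Matrix.GeneralLinearGroup.map (Φ : UnitaryGroup.LocalRing L v →+* UnitaryGroup.LocalRing L' v') (g.val : GL (Fin 2) (UnitaryGroup.LocalRing L v)))
  (e₁ : (UnitaryGroup.cmDatum L 1 (Matrix.of fun i j : Fin 1 => if i.val + j.val + 1 = 1 then (1 : L) else 0)).Local v ≃ₜ*
    (UnitaryGroup.cmDatum L' 1 (Matrix.of fun i j : Fin 1 => if i.val + j.val + 1 = 1 then (1 : L') else 0)).Local v')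
  (eH : ((UnitaryGroup.cmDatum L 2 (Matrix.of fun i j : Fin 2 => if i.val + j.val + 1 = 2 then (1 : L) else 0)).Local v ×
      (UnitaryGroup.cmDatum L 1 (Matrix.of fun i j : Fin 1 => if i.val + j.val + 1 = 1 then (1 : L) else 0)).Local v) ≃ₜ*
    ((UnitaryGroup.cmDatum L' 2 (Matrix.of fun i j : Fin 2 => if i.val + j.val + 1 = 2 then (1 : L') else 0)).Local v' ×
      (UnitaryGroup.cmDatum L' 1 (Matrix.of fun i j : Fin 1 => if i.val + j.val + 1 = 1 then (1 : L') else 0)).Local v'))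
  (heH : ∀ h, eH h = (e₂ h.1, e₁ h.2))
  (χ₂ : ↥(torusU (conjLocal L (IsCMField.complexConj L) v) (cmLocalForm L 2 v)) →* ℂˣ)
  (χ₁ : (UnitaryGroup.cmDatum L 1 (Matrix.of fun i j : Fin 1 => if i.val + j.val + 1 = 1 then (1 : L) else 0)).Local v →* ℂˣ)
  (χ₂' : ↥(torusU (conjLocal L' (IsCMField.complexConj L') v') (cmLocalForm L' 2 v')) →* ℂˣ)
  (χ₁' : (UnitaryGroup.cmDatum L' 1 (Matrix.of fun i j : Fin 1 => if i.val + j.val + 1 = 1 then (1 : L') else 0)).Local v' →* ℂˣ)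
  (hχ₂ : ∀ (t : ↥(torusU (conjLocal L (IsCMField.complexConj L) v) (cmLocalForm L 2 v)))
    (ht' : (e₂ t.1) ∈ torusU (conjLocal L' (IsCMField.complexConj L') v') (cmLocalForm L' 2 v')), χ₂' ⟨e₂ t.1, ht'⟩ = χ₂ t)
  (hχ₁ : ∀ g, χ₁' (e₁ g) = χ₁ g)

include he₂ heH hχ₂ hχ₁ in
set_option maxHeartbeats 1600000 in
/-- **`i_H(χ₂ ⊠ χ₁) ≅ i_{H′}(χ₂′ ⊠ χ₁′) ∘ e_H`** for `e_H = e₂ × e₁` (`i_H(χ₂ ⊠ χ₁)(g₂, g₁) = χ₁(g₁) · i(χ₂)(g₂)`, ★ `cmPrincipalSeriesH_apply`; §1 on the `U(Φ₂)`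
factor, `χ₁′ ∘ e₁ = χ₁` on the `U(Φ₁)` factor). [cite: Rogawski1990, §12.1 p. 171; §14.2 p. 232] -/
theorem nonempty_equiv_cmPrincipalSeriesH_transport :
    Nonempty (Representation.Equiv (cmPrincipalSeriesH L v χ₂ χ₁)
      ((cmPrincipalSeriesH L' v' χ₂' χ₁').comp
        (eH : ((UnitaryGroup.cmDatum L 2 (Matrix.of fun i j : Fin 2 => if i.val + j.val + 1 = 2 then (1 : L) else 0)).Local v ×
            (UnitaryGroup.cmDatum L 1 (Matrix.of fun i j : Fin 1 => if i.val + j.val + 1 = 1 then (1 : L) else 0)).Local v) →*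
          ((UnitaryGroup.cmDatum L' 2 (Matrix.of fun i j : Fin 2 => if i.val + j.val + 1 = 2 then (1 : L') else 0)).Local v' ×
            (UnitaryGroup.cmDatum L' 1 (Matrix.of fun i j : Fin 1 => if i.val + j.val + 1 = 1 then (1 : L') else 0)).Local v')))) := by
  obtain ⟨E⟩ := nonempty_equiv_cmPrincipalSeries_transport L v L' v' Φ 2 e₂ he₂ χ₂ χ₂' hχ₂
  haveI := locallyCompactSpace_cmBorelU L 2 v
  haveI := locallyCompactSpace_cmBorelU L' 2 v'
  exact nonempty_equiv_twist_fst_snd_comp (A := (UnitaryGroup.cmDatum L 2 (Matrix.of fun i j : Fin 2 => if i.val + j.val + 1 = 2 then (1 : L) else 0)).Local v) (A' := (UnitaryGroup.cmDatum L' 2 (Matrix.of fun i j : Fin 2 => if i.val + j.val + 1 = 2 then (1 : L') else 0)).Local v')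
    (B := (UnitaryGroup.cmDatum L 1 (Matrix.of fun i j : Fin 1 => if i.val + j.val + 1 = 1 then (1 : L) else 0)).Local v) (B' := (UnitaryGroup.cmDatum L' 1 (Matrix.of fun i j : Fin 1 => if i.val + j.val + 1 = 1 then (1 : L') else 0)).Local v')
    (cmPrincipalSeries L 2 v χ₂) (cmPrincipalSeries L' 2 v' χ₂')
    (e₂ : (UnitaryGroup.cmDatum L 2 (Matrix.of fun i j : Fin 2 => if i.val + j.val + 1 = 2 then (1 : L) else 0)).Local v →*
      (UnitaryGroup.cmDatum L' 2 (Matrix.of fun i j : Fin 2 => if i.val + j.val + 1 = 2 then (1 : L') else 0)).Local v') E χ₁ χ₁'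
    (e₁ : (UnitaryGroup.cmDatum L 1 (Matrix.of fun i j : Fin 1 => if i.val + j.val + 1 = 1 then (1 : L) else 0)).Local v →*
      (UnitaryGroup.cmDatum L' 1 (Matrix.of fun i j : Fin 1 => if i.val + j.val + 1 = 1 then (1 : L') else 0)).Local v')
    (fun g => by simpa only [MonoidHom.coe_coe] using hχ₁ g)
    (eH : ((UnitaryGroup.cmDatum L 2 (Matrix.of fun i j : Fin 2 => if i.val + j.val + 1 = 2 then (1 : L) else 0)).Local v ×
        (UnitaryGroup.cmDatum L 1 (Matrix.of fun i j : Fin 1 => if i.val + j.val + 1 = 1 then (1 : L) else 0)).Local v) →*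
      ((UnitaryGroup.cmDatum L' 2 (Matrix.of fun i j : Fin 2 => if i.val + j.val + 1 = 2 then (1 : L') else 0)).Local v' ×
        (UnitaryGroup.cmDatum L' 1 (Matrix.of fun i j : Fin 1 => if i.val + j.val + 1 = 1 then (1 : L') else 0)).Local v'))
    (fun h => by simpa only [MonoidHom.coe_coe] using heH h)

include he₂ heH hχ₂ hχ₁ in
set_option maxHeartbeats 1600000 in
/-- **THE LENGTH-TWO LABELS TRANSPORT**: `JH(i_H(χ₂ ⊠ χ₁)) = {π₁, πSt}` at `(L, v)` gives `JH(i_{H′}(χ₂′ ⊠ χ₁′)) = {e_H^* π₁, e_H^* πSt}` at `(L′, v′)`,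
`e_H^* = IrrClass.comap e_H⁻¹` a bijection (★ `comap_isConstituentOf_comp_iff`, ★ `isConstituentOf_congr` along §2's equivalence). «The map `π ↦ π ∘ e`
identifies `JH(i_G(χ))` with `JH(i_{G′}(χ ∘ e))`.» [cite: Rogawski1990, §12.1 pp. 171–172; §12.2 p. 173] [cite: BushnellHenniart2006, §1.1] -/
theorem hLengthTwoLabels_transport
    (π₁ πSt : IrrClass ((UnitaryGroup.cmDatum L 2 (Matrix.of fun i j : Fin 2 => if i.val + j.val + 1 = 2 then (1 : L) else 0)).Local v ×
      (UnitaryGroup.cmDatum L 1 (Matrix.of fun i j : Fin 1 => if i.val + j.val + 1 = 1 then (1 : L) else 0)).Local v))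
    (h : HLengthTwoLabels L v χ₂ χ₁ π₁ πSt) :
    HLengthTwoLabels L' v' χ₂' χ₁' (IrrClass.comap eH.symm π₁) (IrrClass.comap eH.symm πSt) := by
  obtain ⟨E⟩ := nonempty_equiv_cmPrincipalSeriesH_transport L v L' v' Φ e₂ he₂ e₁ eH heH χ₂ χ₁ χ₂' χ₁' hχ₂ hχ₁
  refine ⟨fun heq => h.1 (IrrClass.comap_injective eH.symm heq), fun c => ?_⟩
  have h1 : c.IsConstituentOf (cmPrincipalSeriesH L' v' χ₂' χ₁') ↔
      (IrrClass.comap eH c).IsConstituentOf (cmPrincipalSeriesH L v χ₂ χ₁) := by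
    rw [IrrClass.isConstituentOf_congr E (IrrClass.comap eH c)]
    exact (IrrClass.comap_isConstituentOf_comp_iff eH _ c).symm
  rw [h1, h.2 (IrrClass.comap eH c)]
  constructor
  · rintro (hc | hc)
    · exact Or.inl (by rw [← hc, IrrClass.comap_symm_comap])
    · exact Or.inr (by rw [← hc, IrrClass.comap_symm_comap])
  · rintro (hc | hc)
    · exact Or.inl (by rw [hc, IrrClass.comap_comap_symm])
    · exact Or.inr (by rw [hc, IrrClass.comap_comap_symm])

end Labels

end Summit.HodgeConjecture.HodgeConjecture.R90.S10

end
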